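import Literature.AlgebraicGeometry.Hu2025.Statements.S05ThetaBlowups.R106bThetaFrame
import Mathlib.RingTheory.MvPolynomial.WeightedHomogeneous

/-!
# Hu 2025 (arXiv:2507.21400v1), §5.3–§5.4: Def. 5.9, Prop. 5.11, (conv:=1), Prop. 5.12, Def. 5.13, Def. 5.15, (fV-fV0) —
# file `S05ThetaBlowups/R106cThetaBlowups.lean` of row 106 (FILED by res-type-023 (gen 9) as row-106 owner per the M-Hu re-pointing line 2026-08-27T08:00:07Z (director-resolution g4, M-Hu-min OPEN; REPOINT LIST OF RECORD res-dag-1 04:27Z); T9: every locator re-read on the chunks in this seat 2026-08-27T05:4xZ; pre-drafts g4–g9 under HOME/plan/tools/res-type-023/hu/). Items ↦ decls,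
# frame dictionary, reading/sic notes: module docstring of `R106bThetaFrame`. Source status and tags as there:
# `[claim: Hu2025, status: under-review]` — «STATUS: candidate statement under adjudication (D-0012/D-0089); not asserted».
-/

noncomputable section

open MvPolynomial

namespace Literature.AlgebraicGeometry.Hu2025.Statements.S05ThetaBlowups

universe u v

namespace ThetaFrame

variable {P : Type v} {Rs : Type v} [DecidableEq P] [DecidableEq Rs]
variable (Φ : ThetaFrame P Rs)

section WithRing

variable (R : Type u) [CommRing R]

/-! ### Def. 5.9 / Def. 5.15 — the ϑ-centres and the ϑ-steps seen from a chart over `𝔙_[0]` -/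

/-- **Definition 5.9 (C36L96–L108; p.84), the ϑ-set and ϑ-centre on the chart `𝔙_[0]`.** «Fix any u ∈ 𝕀^lt_{3,n}. We let
ϑ_u = (X_u, X_{((123),u)}). We call it the ϑ-set with respect to u. We then call the scheme-theoretic intersection
Z_{ϑ_u} = X_u ∩ X_{((123),u)} the ϑ-center with respect to u.» With Def. 4.53 ‹4.52› C32L55–L73 («X_u := (x_u = 0)»,
«X_{(u,v)} := (x_{(u,v)} = 0)»): on `𝔙_[0]` the ideal of `Z_{ϑ_{u_k}} ∩ 𝔙_[0]` is `(x_{u_k}, x_{(m,u_k)})` — the whole ring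
(empty intersection) when `x_{(m,u_k)} ≡ 1` on the chart. C36L110–L124: «Θ = {ϑ_u ∣ u ∈ 𝕀^lt}, 𝒵_Θ = {Z_{ϑ_u} ∣ u ∈ 𝕀^lt} …
inherit the total order from 𝕀^lt … 𝒵_Θ = {Z_{ϑ_[1]} < ⋯ < Z_{ϑ_[Υ]}}» = the indexing by `k : Fin Υ`.
[claim: Hu2025, status: under-review]
STATUS: candidate statement under adjudication (D-0012/D-0089); not asserted. -/
def thetaCentreIdeal (k : Fin Φ.N) : Ideal (MvPolynomial (P ⊕ Rs) R) :=
  Ideal.span {X (Sum.inl (Φ.ult k)), xOpt R (Φ.lead k)}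

/-- **Definition 5.9 under its printed name:** `Def5_9 Φ R k` = the chart ideal on `𝔙_[0]` of the ϑ-centre `Z_{ϑ_[k]}`
(C36L96–L124; p.84). Alias of `ThetaFrame.thetaCentreIdeal`. The blow-up sequence (C36L126–L140 «We then blow up ℛ along
Z_{ϑ_[k]}, k ∈ [Υ], in the above order … ℛ̃_{ϑ[k]} → ℛ̃_{ϑ[k−1]} be the blowup of ℛ̃_{ϑ[k−1]} along the proper transform of
Z_{ϑ_[k]}, and we call it the ϑ-blowup in (ϑ_[k])»; (vt-sequence) C36L138–L140) is, chart by chart, `ThetaFrame.seq`; the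
exceptional divisors `E_{ϑ[k],j}` (C36L142–L147) are carried by `ThetaFrame.eSet`/`dSet` (Prop. 5.11).
[claim: Hu2025, status: under-review]
STATUS: candidate statement under adjudication (D-0012/D-0089); not asserted. -/
abbrev _root_.Literature.AlgebraicGeometry.Hu2025.Statements.S05ThetaBlowups.Def5_9
    (Φ : ThetaFrame P Rs) (R : Type u) [CommRing R] (k : Fin Φ.N) : Ideal (MvPolynomial (P ⊕ Rs) R) :=
  Φ.thetaCentreIdeal R k


/-- **The `k`-th ϑ-step seen from a chart over `𝔙_[0]` (Prop. 5.11 proof C37L110–C38L27; Def. 5.15 C38L99–L109; p.87–89).**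
If `(m,u_k) ∈ Λ^o` there is no step on the chart (C37L110–L116, identity). Otherwise the proper transform of the centre on `𝔙'`
is `(x_{𝔙',u_k}, x_{𝔙',(m,u_k)})` (C37L132–L136 «Z'_{ϑ_k} ∩ 𝔙' = {x_{𝔙',u_k} = x_{𝔙',(m,u_k)} = 0}»; C39L131–L134, C40L66–L67)
and the step is the `ChartStep` with centre `{u_k, (m,u_k)}` and
exceptional index `u_k` on the ϖ-standard chart («ε_{𝔙,u_k} = x_{𝔙',u_k}, x_{𝔙,(m,u_k)} = ξ_1», C37L141–L150: substitution
`x_{𝔙',(m,u_k)} = x_{𝔙',u_k} ξ_1`) resp. `(m,u_k)` on the ϱ-standard chart («δ_{𝔙,(m,u_k)} = x_{𝔙',(m,u_k)}, x_{𝔙,u_k} = ξ_0»,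
C38L11–L20: substitution `x_{𝔙',u_k} = x_{𝔙',(m,u_k)} ξ_0`) — exactly `ChartStep.pullback` of `R106aCharts` on the fixed index
type (the new variable `ξ_1` resp. `ξ_0` keeps the index `(m,u_k)` resp. `u_k`, C38L3 / C38L24 «is the proper transform of»).
[claim: Hu2025, status: under-review]
STATUS: candidate statement under adjudication (D-0012/D-0089); not asserted. -/
def step (c : Φ.Chart) (k : Fin Φ.N) : Option (ChartStep (P ⊕ Rs)) :=
  (Φ.lead k).elim none fun r =>
    some { centre := {Sum.inl (Φ.ult k), Sum.inr r}
           exc := (c k).by (Sum.inl (Φ.ult k)) (Sum.inr r)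
           exc_mem :=
             ThetaKind.rec
               (motive := fun κ => κ.by (Sum.inl (Φ.ult k)) (Sum.inr r) ∈
                 ({Sum.inl (Φ.ult k), Sum.inr r} : Finset (P ⊕ Rs)))
               (Finset.mem_insert_self _ _) (Finset.mem_insert_of_mem (Finset.mem_singleton_self _)) (c k) }

/-- The word of steps `ϑ_[a+1], …, ϑ_[b]` (printed numbering) performed on the chart `c`, root first, no-change steps omitted:
the part of the sequence (vt-sequence) C36L138–L140 between levels `a` and `b`, seen from `𝔙_[0]`. `Φ.seq c 0 k` is the
standard chart `𝔙` of `ℛ̃_{ϑ[k]}` determined by `c` as a `ChartSeq` over `𝔙_[0]` (Def. 5.1 «lies over»).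
[claim: Hu2025, status: under-review]
STATUS: candidate statement under adjudication (D-0012/D-0089); not asserted. -/
def seq (c : Φ.Chart) (a b : ℕ) : ChartSeq (P ⊕ Rs) :=
  ((List.finRange Φ.N).filter fun k : Fin Φ.N => decide (a ≤ k.val ∧ k.val < b)).filterMap (Φ.step c)

/-- **Definition 5.15, ϖ-standard chart (C38L99–L106; p.89):** «we call 𝔙 = ℛ̃_{ϑ[k]} ∩ (𝔙' × (ξ_0 ≡ 1)) a ϖ-standard chart
of ℛ̃_{ϑ[k]}» — for the chart of `ℛ̃_{ϑ[k+1]}` (printed `k+1`) recorded by `c`: the last step exists on the chart and is `varpi`.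
[claim: Hu2025, status: under-review]
STATUS: candidate statement under adjudication (D-0012/D-0089); not asserted. -/
def _root_.Literature.AlgebraicGeometry.Hu2025.Statements.S05ThetaBlowups.Def5_15_varpi
    (Φ : ThetaFrame P Rs) (c : Φ.Chart) (k : Fin Φ.N) : Prop :=
  Φ.lead k ≠ none ∧ c k = ThetaKind.varpi

/-- **Definition 5.15, ϱ-standard chart (C38L106–L109; p.89):** «we call 𝔙 = ℛ̃_{ϑ[k]} ∩ (𝔙' × (ξ_1 ≡ 1)) a ϱ-standard chart
of ℛ̃_{ϑ[k]}».
[claim: Hu2025, status: under-review]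
STATUS: candidate statement under adjudication (D-0012/D-0089); not asserted. -/
def _root_.Literature.AlgebraicGeometry.Hu2025.Statements.S05ThetaBlowups.Def5_15_varrho
    (Φ : ThetaFrame P Rs) (c : Φ.Chart) (k : Fin Φ.N) : Prop :=
  Φ.lead k ≠ none ∧ c k = ThetaKind.varrho

/-! ### Prop. 5.11 — the labels `𝔢_𝔙`, `𝔡_𝔙` and the variables of a standard chart of `ℛ̃_{ϑ[k]}` -/

/-- **`𝔢_𝔙 ⊂ 𝕀^⋆_{3,n}` (Prop. 5.11 C37L32–L43; p.86; recursion C37L96 «𝔢_𝔙 = 𝔡_𝔙 = ∅» for k = 0, C37L114–L115 (no-change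
step: unchanged), C37L147 «𝔢_𝔙 = u_k ⊔ 𝔢_{𝔙'}, 𝔡_𝔙 = 𝔡_{𝔙'}» (ϖ-chart), C38L17 «𝔢_𝔙 = 𝔢_{𝔙'}, 𝔡_𝔙 = {(m,u_k)} ⊔ 𝔡_{𝔙'}»
(ϱ-chart)):** the ϖ-indices labelling the ϖ-exceptional divisors `E_{ϑ[k],w}` meeting the chart `𝔙` of `ℛ̃_{ϑ[k]}` given by `c`.
[claim: Hu2025, status: under-review]
STATUS: candidate statement under adjudication (D-0012/D-0089); not asserted. -/
def eSet (c : Φ.Chart) (k : ℕ) : Finset P :=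
  ((List.finRange Φ.N).filterMap fun j : Fin Φ.N =>
      (Φ.lead j).elim none fun _ => (c j).by (if j.val < k then some (Φ.ult j) else none) none).toFinset

/-- **`𝔡_𝔙 ⊂ Λ^⋆_𝔉` (Prop. 5.11 C37L32–L45; p.86; recursion as for `eSet`):** the ϱ-indices labelling the ϱ-exceptional divisors
`E_{ϑ[k],(u,v)}` meeting the chart.
[claim: Hu2025, status: under-review]
STATUS: candidate statement under adjudication (D-0012/D-0089); not asserted. -/
def dSet (c : Φ.Chart) (k : ℕ) : Finset Rs :=
  ((List.finRange Φ.N).filterMap fun j : Fin Φ.N =>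
      (Φ.lead j).elim none fun r => (c j).by none (if j.val < k then some r else none)).toFinset

/-- **The ϖ-exceptional variable `ε_{𝔙,w}`, `w ∈ 𝔢_𝔙` ((var-vtk) C37L51–L62, C37L81–L83 «E_{ϑ[k],w} ∩ 𝔙 … is define[d] by
(ε_{𝔙,w} = 0)»):** on the fixed index type it is the variable of index `w` (C37L149 «ε_{𝔙,u_k} = x_{𝔙',u_k}»). Name only.
[claim: Hu2025, status: under-review]
STATUS: candidate statement under adjudication (D-0012/D-0089); not asserted. -/
def epsVar (w : P) : MvPolynomial (P ⊕ Rs) R := X (Sum.inl w)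

/-- **The ϱ-exceptional variable `δ_{𝔙,(u,v)}`, `(u,v) ∈ 𝔡_𝔙` ((var-vtk) C37L51–L62, C37L85–L87):** the variable of index `(u,v)`
(C38L19 «δ_{𝔙,(m,u_k)} = x_{𝔙',(m,u_k)}»). Name only.
[claim: Hu2025, status: under-review]
STATUS: candidate statement under adjudication (D-0012/D-0089); not asserted. -/
def deltaVar (r : Rs) : MvPolynomial (P ⊕ Rs) R := X (Sum.inr r)

/-- **Convention (conv:=1) C38L32–L39 (p.88), ϖ-part:** «x_{𝔙,u} with u ∈ 𝔢_𝔙 … are not variables in Var_𝔙. For notational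
convenience … • x_{𝔙,u} = 1 if u ∈ 𝔢_𝔙».
[claim: Hu2025, status: under-review]
STATUS: candidate statement under adjudication (D-0012/D-0089); not asserted. -/
def C38L37_xP (c : Φ.Chart) (k : ℕ) (w : P) : MvPolynomial (P ⊕ Rs) R :=
  if w ∈ Φ.eSet c k then 1 else X (Sum.inl w)

/-- **Convention (conv:=1) C38L32–L39 (p.88), ϱ-part:** «• x_{𝔙,(u,v)} = 1 if (u,v) ∈ 𝔡_𝔙» (and `= 1` for the chart's `≡ 1`
coordinate of `𝔙_[0]`, `none`).
[claim: Hu2025, status: under-review]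
STATUS: candidate statement under adjudication (D-0012/D-0089); not asserted. -/
def C38L37_xR (c : Φ.Chart) (k : ℕ) (o : Option Rs) : MvPolynomial (P ⊕ Rs) R :=
  o.elim 1 fun r => if r ∈ Φ.dSet c k then 1 else X (Sum.inr r)

/-- **(fV-fV0) `π_{𝔙,𝔙_[0]} : 𝔙 → 𝔙_[0]`, the induced projection (Def. 5.15 C38L111–L122; p.89), as the pull-back of
coordinate rings** along the word of the chart (`ChartSeq.pullback`); Prop. 5.16 C38L147–L150 «x̃_{𝔙,u_s} = π^*_{𝔙,𝔙_[0]}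
x_{𝔙_[0],u_s} … are monomials in Var_𝔙».
[claim: Hu2025, status: under-review]
STATUS: candidate statement under adjudication (D-0012/D-0089); not asserted. -/
def proj (c : Φ.Chart) (k : ℕ) : MvPolynomial (P ⊕ Rs) R →ₐ[R] MvPolynomial (P ⊕ Rs) R :=
  (Φ.seq c 0 k).pullback (R := R)

/-- `x̃_{𝔙,w} = π^*_{𝔙,𝔙_[0]} x_{𝔙_[0],w}` for `w ∈ 𝕀^⋆` (Prop. 5.16 C38L147–L150, C39L91–L92 «x̃_{𝔙,w} = π^*_{𝔙,𝔙_[0]} x_{𝔙_[0],w}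
denoted the pullback for any w ∈ 𝕀_{3,n} ∖ m»).
[claim: Hu2025, status: under-review]
STATUS: candidate statement under adjudication (D-0012/D-0089); not asserted. -/
def xTilde (c : Φ.Chart) (k : ℕ) (w : P) : MvPolynomial (P ⊕ Rs) R := Φ.proj R c k (X (Sum.inl w))

/-! ### C38L41–L54 — `Ṽ_{ϑ[k]}` on the chart (OURS carrier); Def. 5.13 — the transforms `B_𝔙`, `L_{𝔙,F}` -/

/-- **`Ṽ_{ϑ[k]} ∩ 𝔙` as an ideal of the chart ring (diagram C38L41–L50 «Ṽ_{ϑ[k]} is the proper transform of 𝒱 in ℛ̃_{ϑ[k]}»;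
C38L52–L54 «Alternatively … Ṽ_{ϑ[k]} ⊂ ℛ̃_{ϑ[k]} be the proper transform of Ṽ_{ϑ[k−1]}») — OURS CARRIER: the strict transform
(`ChartStep.strictTransform`, ζ-saturation of the total transform) of `idealV0` iterated along the word of the chart. The
manuscript gives no chart-level definition of «proper transform» of a subscheme; its EQUATIONS for this ideal are Prop. 5.16's
list (`equationsAt`) — the comparison is joint J3 (G-H2).**
[claim: Hu2025, status: under-review]
STATUS: candidate statement under adjudication (D-0012/D-0089); not asserted — OURS carrier. -/
def idealVTilde (c : Φ.Chart) (k : ℕ) : Ideal (MvPolynomial (P ⊕ Rs) R) :=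
  (Φ.seq c 0 k).strictTransform R (Φ.idealV0 R)

/-- **Definition 5.13, binomial part (C38L64–L73; p.88):** «When k = 0, we let B_𝔙 and L_{𝔙,F} be as in Proposition (equas-p-k=0)
for any B ∈ 𝓑^gov ∪ 𝓑^ngv ∪ 𝓑^𝔯𝔟 and F ∈ 𝔉. … Suppose B_𝔙' and L_{𝔙',F} have been constructed over 𝔙'. Applying Definition
(general-proper-transforms), we obtain their proper transforms on the chart 𝔙: B_𝔙, ∀ B ∈ 𝓑^gov ∪ 𝓑^ngv ∪ 𝓑^𝔯𝔟». Typed: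
the iterated TERM-WISE proper transform (Def. 5.4, binomial clause) of a chart binomial of `𝔙_[0]` along the word.
[claim: Hu2025, status: under-review]
STATUS: candidate statement under adjudication (D-0012/D-0089); not asserted. -/
def transformB (c : Φ.Chart) (k : ℕ) (B : Binomial (P ⊕ Rs)) : Binomial (P ⊕ Rs) := (Φ.seq c 0 k).properTransform B

/-- **Definition 5.13, linear part (C38L72–L73; p.88):** «L_{𝔙,F}, ∀ F ∈ 𝔉» — by Def. 5.4's general-polynomial clause
(C35L38–L42 «f_𝔙 = π^* f … the pullback … we also call f_𝔙 the proper transform») the iterated transform of `L_{𝔙_[0],F}` is its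
PULL-BACK along the word (consistent with the displays C38L140–L141 / C39L7–L8). This does NOT weaken Prop. 5.11 bullet (3)'s «proper transform of L_F» (C37L74–L75): at every ϑ-step the centre `{x_{u_k}, x_{(m,u_k)}}` meets exactly one term of `L_{F_k}` (the leading one) and no term of `L_{F_j}`, `j ≠ k` (standing facts (iv)), so the pull-back is never divisible by the exceptional parameter and pull-back = proper (= strict) transform for these linear forms (kernel: `Prop5_11_holds`, bullet (3); lane-B pre-read N106-4 2026-08-27T07:03Z).
[claim: Hu2025, status: under-review]
STATUS: candidate statement under adjudication (D-0012/D-0089); not asserted. -/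
def linAt (c : Φ.Chart) (k : ℕ) (j : Fin Φ.N) : MvPolynomial (P ⊕ Rs) R := Φ.proj R c k (Φ.lin0 R j)

/-- `B_{𝔙,(s_{F_j},s_τ)}`: the Def. 5.13 transform (C38L64–L73 «B_𝔙, ∀ B ∈ 𝓑^gov ∪ 𝓑^ngv ∪ 𝓑^𝔯𝔟»; p.88) of the governing
binomial `B_(jτ)` ((eq-B-ktau) C36L13–L15) on the chart of `ℛ̃_{ϑ[k]}` given by `c`.
[claim: Hu2025, status: under-review]
STATUS: candidate statement under adjudication (D-0012/D-0089); not asserted. -/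
def govAt (c : Φ.Chart) (k : ℕ) (j : Fin Φ.N) (τ : Fin (Φ.t j)) : Binomial (P ⊕ Rs) := Φ.transformB c k (Φ.gov0 j τ)

/-- `B_{𝔙,(s,t)}`: the Def. 5.13 transform (C38L64–L73; p.88) of the non-governing binomial `B_{F_j,(s_τ,s_τ')}` (chart form
C33L1–L3).
[claim: Hu2025, status: under-review]
STATUS: candidate statement under adjudication (D-0012/D-0089); not asserted. -/
def ngvAt (c : Φ.Chart) (k : ℕ) (j : Fin Φ.N) (τ τ' : Fin (Φ.t j)) : Binomial (P ⊕ Rs) :=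
  Φ.transformB c k (Φ.ngv0 j τ τ')

/-- `𝓑^𝔯𝔟_𝔙`: the Def. 5.13 transforms (C38L64–L73 «B_𝔙, ∀ B ∈ 𝓑^gov ∪ 𝓑^ngv ∪ 𝓑^𝔯𝔟»; p.88) of the 𝔯𝔟-binomials on the
chart (listed first in Prop. 5.16, C38L135 / C39L2 «𝓑^𝔯𝔟_𝔙»).
[claim: Hu2025, status: under-review]
STATUS: candidate statement under adjudication (D-0012/D-0089); not asserted. -/
def rbAt (c : Φ.Chart) (k : ℕ) : Set (Binomial (P ⊕ Rs)) := Φ.transformB c k '' Φ.rb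

/-- **Definition 5.13 under its printed name (binomials):** `Def5_13_B Φ c k B` = `B_𝔙` (C38L64–L73; p.88).
[claim: Hu2025, status: under-review]
STATUS: candidate statement under adjudication (D-0012/D-0089); not asserted. -/
abbrev _root_.Literature.AlgebraicGeometry.Hu2025.Statements.S05ThetaBlowups.Def5_13_B
    (Φ : ThetaFrame P Rs) (c : Φ.Chart) (k : ℕ) (B : Binomial (P ⊕ Rs)) : Binomial (P ⊕ Rs) := Φ.transformB c k B

/-- **Definition 5.13 under its printed name (linearized relations):** `Def5_13_L Φ R c k j` = `L_{𝔙,F_j}` (C38L72–L73; p.88).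
[claim: Hu2025, status: under-review]
STATUS: candidate statement under adjudication (D-0012/D-0089); not asserted. -/
abbrev _root_.Literature.AlgebraicGeometry.Hu2025.Statements.S05ThetaBlowups.Def5_13_L
    (Φ : ThetaFrame P Rs) (R : Type u) [CommRing R] (c : Φ.Chart) (k : ℕ) (j : Fin Φ.N) : MvPolynomial (P ⊕ Rs) R :=
  Φ.linAt R c k j

/-! ### Prop. 5.11 — the divisors on a standard chart of `ℛ̃_{ϑ[k]}` -/

/-- **Chart ideal of the ϖ-divisor `X_{ϑ[k],w} ∩ 𝔙`** (C37L1–L4 «X_{ϑ[k],w} be the proper transform of X_w in ℛ̃_{ϑ[k]}, still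
called ϖ-divisor»; Def. 4.53 ‹4.52› C32L60–L64 «X_w := (x_w = 0)»): the strict transform (OURS VOCABULARY) of `(x_w)` along the
word of the chart.
[claim: Hu2025, status: under-review]
STATUS: candidate statement under adjudication (D-0012/D-0089); not asserted. -/
def plDivAt (c : Φ.Chart) (k : ℕ) (w : P) : Ideal (MvPolynomial (P ⊕ Rs) R) :=
  (Φ.seq c 0 k).strictTransform R (Ideal.span {X (Sum.inl w)})

/-- **Chart ideal of the ϱ-divisor `X_{ϑ[k],(u,v)} ∩ 𝔙`** (C37L5–L8; Def. 4.53 ‹4.52› C32L67–L73 «X_{(u,v)} := (x_{(u,v)} = 0)»).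
[claim: Hu2025, status: under-review]
STATUS: candidate statement under adjudication (D-0012/D-0089); not asserted. -/
def rhoDivAt (c : Φ.Chart) (k : ℕ) (r : Rs) : Ideal (MvPolynomial (P ⊕ Rs) R) :=
  (Φ.seq c 0 k).strictTransform R (Ideal.span {X (Sum.inr r)})

/-- **Chart ideal of the 𝔏-divisor `D_{ϑ[k],L_F} ∩ 𝔙`** (C37L9–L11 «D_{ϑ[k],L_F} be the proper transform of D_{L_F}»; Def. 4.53
‹4.52› C32L76–L82 «D_{L_F} := (L_F = 0)»).
[claim: Hu2025, status: under-review]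
STATUS: candidate statement under adjudication (D-0012/D-0089); not asserted. -/
def LDivAt (c : Φ.Chart) (k : ℕ) (j : Fin Φ.N) : Ideal (MvPolynomial (P ⊕ Rs) R) :=
  (Φ.seq c 0 k).strictTransform R (Ideal.span {Φ.lin0 R j})

/-- **Chart ideal of the exceptional divisor `E_{ϑ[k],j}` on the chart of `ℛ̃_{ϑ[k]}`** (C36L142–L147 «Every blowup
ℛ̃_{ϑ[j]} → ℛ̃_{ϑ[j−1]} comes equipped with an exceptional divisor E_{ϑ[j]} … E_{ϑ[k],j} be the proper transform of E_{ϑ[j]} in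
ℛ̃_{ϑ[k]}»; C38L1–L2 «E_{ϑ[k]} ∩ 𝔙 = (ε_{𝔙,u_k} = 0)», C38L22–L23 «= (δ_{𝔙,(m,u_k)} = 0)»): for a step present on the chart and
already performed (`j < k`, `lead j ≠ none`) the strict transform along the LATER steps of its exceptional ideal; the unit ideal
(«does not intersect the chart») otherwise. Lean `j : Fin Υ` = printed `j+1`.
[claim: Hu2025, status: under-review]
STATUS: candidate statement under adjudication (D-0012/D-0089); not asserted. -/
def excDivAt (c : Φ.Chart) (k : ℕ) (j : Fin Φ.N) : Ideal (MvPolynomial (P ⊕ Rs) R) :=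
  if j.val < k then
    (Φ.lead j).elim ⊤ fun r =>
      (Φ.seq c (j + 1) k).strictTransform R (Ideal.span {(c j).by (epsVar R (Φ.ult j)) (deltaVar R r)})
  else ⊤

/-- **The label of the exceptional divisor `E_{ϑ[k],j}` on the chart** (Prop. 5.11 C37L37–L45 «every exceptional divisor
E_{ϑ[k],j}, j ∈ [k] … with E_{ϑ[k],j} ∩ 𝔙 ≠ ∅ is either labeled by a unique element w ∈ 𝔢_𝔙 or labeled by a unique element
(u,v) ∈ 𝔡_𝔙»): `u_j` on a ϖ-step, `(m,u_j)` on a ϱ-step, none for a no-change step or a step not yet performed.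
[claim: Hu2025, status: under-review]
STATUS: candidate statement under adjudication (D-0012/D-0089); not asserted. -/
def labAt (c : Φ.Chart) (k : ℕ) (j : Fin Φ.N) : Option (P ⊕ Rs) :=
  if j.val < k then (Φ.lead j).elim none fun r => some ((c j).by (Sum.inl (Φ.ult j)) (Sum.inr r)) else none

/-- **Proposition 5.11, first paragraph (C37L32–L47; p.86):** «the standard chart 𝔙 comes equipped with a subset 𝔢_𝔙 ⊂ 𝕀^⋆
and a subset 𝔡_𝔙 ⊂ Λ^⋆_𝔉 such that every exceptional divisor E_{ϑ[k],j}, j ∈ [k] of ℛ̃_{ϑ[k]} with E_{ϑ[k],j} ∩ 𝔙 ≠ ∅ is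
either labeled by a unique element w ∈ 𝔢_𝔙 or labeled by a unique element (u,v) ∈ 𝔡_𝔙. We let E_{ϑ[k],w} be the unique
exceptional divisor on the chart 𝔙 labeled by w ∈ 𝔢_𝔙 … E_{ϑ[k],(u,v)} … labeled by (u,v) ∈ 𝔡_𝔙». Typed: an exceptional divisor
meeting the chart (ideal `≠ ⊤`) carries a label; labels lie in `𝔢_𝔙 ⊔ 𝔡_𝔙`; distinct divisors carry distinct labels; every
element of `𝔢_𝔙 ⊔ 𝔡_𝔙` labels some divisor — under the standing facts `Φ.IsStandard` of the frame (v3: the printed frame has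
`u_1 < ⋯ < u_Υ`, C36L120; without them «distinct labels» fails on degenerate frames).
[claim: Hu2025, status: under-review]
STATUS: candidate statement under adjudication (D-0012/D-0089); not asserted. -/
def _root_.Literature.AlgebraicGeometry.Hu2025.Statements.S05ThetaBlowups.Prop5_11_labels
    (Φ : ThetaFrame P Rs) (R : Type u) [CommRing R] : Prop :=
  Φ.IsStandard → ∀ (c : Φ.Chart) (k : ℕ), k ≤ Φ.N →
    (∀ j : Fin Φ.N, Φ.excDivAt R c k j ≠ ⊤ → (Φ.labAt c k j).isSome) ∧
    (∀ (j : Fin Φ.N) (l : P ⊕ Rs), Φ.labAt c k j = some l →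
      Sum.elim (fun w => w ∈ Φ.eSet c k) (fun r => r ∈ Φ.dSet c k) l) ∧
    (∀ (j₁ j₂ : Fin Φ.N) (l : P ⊕ Rs), Φ.labAt c k j₁ = some l → Φ.labAt c k j₂ = some l → j₁ = j₂) ∧
    (∀ l : P ⊕ Rs, Sum.elim (fun w => w ∈ Φ.eSet c k) (fun r => r ∈ Φ.dSet c k) l → ∃ j, Φ.labAt c k j = some l)

/-- **Proposition 5.11 (statement C37L23–L91, proof C37L93–C38L30; p.86–88).** «Consider any standard chart 𝔙 of ℛ̃_{ϑ[k]},
lying over a unique chart 𝔙_[0] of ℛ̃_{ϑ[0]} = ℛ … Then, the standard chart 𝔙 comes equipped with a subset 𝔢_𝔙 ⊂ 𝕀^⋆ and a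
subset 𝔡_𝔙 ⊂ Λ^⋆_𝔉 such that every exceptional divisor E_{ϑ[k],j}, j ∈ [k] … with E_{ϑ[k],j} ∩ 𝔙 ≠ ∅ is either labeled by a unique
element w ∈ 𝔢_𝔙 or labeled by a unique element (u,v) ∈ 𝔡_𝔙 … Further, the standard chart 𝔙 comes equipped with the set of free
variables Var_𝔙 = {ε_{𝔙,w}, δ_{𝔙,(u,v)}; x_{𝔙,w}, x_{𝔙,(u,v)} ∣ w ∈ 𝔢_𝔙, (u,v) ∈ 𝔡_𝔙; w ∈ 𝕀^⋆ ∖ 𝔢_𝔙, (u,v) ∈ Λ^⋆ ∖ 𝔡_𝔙} such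
that on the standard chart 𝔙, we have • the divisor X_{ϑ[k],w} ∩ 𝔙 is defined by (x_{𝔙,w} = 0) for every w ∈ 𝕀^⋆ ∖ 𝔢_𝔙; • the
divisor X_{ϑ[k],(u,v)} ∩ 𝔙 is defined by (x_{𝔙,(u,v)} = 0) for every (u,v) ∈ Λ^⋆ ∖ 𝔡_𝔙; • the divisor D_{ϑ[k],L} ∩ 𝔙 is defined by
(L_{𝔙,F} = 0) for every F ∈ 𝔉 where L_{𝔙,F} is the proper transform of L_F; • the divisor X_{ϑ[k],w} does not intersect the chart
for all w ∈ 𝔢_𝔙; • the divisor X_{ϑ[k],(u,v)} does not intersect the chart for all (u,v) ∈ 𝔡_𝔙; • the ϖ-exceptional divisor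
E_{ϑ[k],w} ∩ 𝔙 … is define[d] by (ε_{𝔙,w} = 0) for all w ∈ 𝔢_𝔙; • the ϱ-exceptional divisor E_{ϑ[k],(u,v)} ∩ 𝔙 … is define[d] by
(δ_{𝔙,(u,v)} = 0) for all (u,v) ∈ 𝔡_𝔙; • any of the remaining exceptional divisor[s] of ℛ̃_{ϑ[k]} … does not intersect the
chart.» Here `X_{ϑ[k],w}`, `X_{ϑ[k],(u,v)}`, `D_{ϑ[k],L_F}` are the proper transforms of the ϖ-, ϱ-, 𝔏-divisors of ℛ (C37L1–L11),
`E_{ϑ[k],j}` the proper transform of the exceptional divisor of the `j`-th step (C36L142–L147). Typed on the word `c`, level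
`k ≤ Υ`, with «proper transform of a divisor» = strict transform of its ideal (OURS VOCABULARY) and `𝔢_𝔙`, `𝔡_𝔙`, `Var_𝔙` =
`eSet`, `dSet`, the variables of the fixed index type, through the chart-divisor ideals `plDivAt`, `rhoDivAt`, `LDivAt`,
`excDivAt` and the label map `labAt` (the SAME shape as row 108's Prop. 6.11 record at `𝔩_𝔙 = ∅` — Prop. 6.11's initial case
IS Prop. 5.11 with k = Υ, C48L64–L68): (1)–(2) `X_{ϑ[k],w} ∩ 𝔙 = (x_{𝔙,w})`, `X_{ϑ[k],(u,v)} ∩ 𝔙 = (x_{𝔙,(u,v)})` for unlabelled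
indices; (3) `D_{ϑ[k],L_F} ∩ 𝔙 = (L_{𝔙,F})` with `L_{𝔙,F}` the pull-back (Def. 5.13); (4)–(5) the unit ideal for labelled indices;
(6)–(7) an exceptional divisor labelled `w` resp. `(u,v)` has chart ideal `(ε_{𝔙,w})` resp. `(δ_{𝔙,(u,v)})`; (8) unlabelled
exceptional divisors have the unit ideal (at this carrier level: the no-change steps and the steps not yet performed). The first
paragraph (every exceptional divisor meeting the chart carries a unique label in `𝔢_𝔙 ⊔ 𝔡_𝔙`) is `Prop5_11_labels`. Stated under the
standing facts `Φ.IsStandard` of the frame (v3; hypotheses explicit, T4).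
[claim: Hu2025, status: under-review]
STATUS: candidate statement under adjudication (D-0012/D-0089); not asserted. -/
def _root_.Literature.AlgebraicGeometry.Hu2025.Statements.S05ThetaBlowups.Prop5_11
    (Φ : ThetaFrame P Rs) (R : Type u) [CommRing R] : Prop :=
  Φ.IsStandard → ∀ (c : Φ.Chart) (k : ℕ), k ≤ Φ.N →
    (∀ w : P, w ∉ Φ.eSet c k → Φ.plDivAt R c k w = Ideal.span {X (Sum.inl w)}) ∧
    (∀ r : Rs, r ∉ Φ.dSet c k → Φ.rhoDivAt R c k r = Ideal.span {X (Sum.inr r)}) ∧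
    (∀ j : Fin Φ.N, Φ.LDivAt R c k j = Ideal.span {Φ.linAt R c k j}) ∧
    (∀ w : P, w ∈ Φ.eSet c k → Φ.plDivAt R c k w = ⊤) ∧
    (∀ r : Rs, r ∈ Φ.dSet c k → Φ.rhoDivAt R c k r = ⊤) ∧
    (∀ (j : Fin Φ.N) (w : P), Φ.labAt c k j = some (Sum.inl w) → Φ.excDivAt R c k j = Ideal.span {epsVar R w}) ∧
    (∀ (j : Fin Φ.N) (r : Rs), Φ.labAt c k j = some (Sum.inr r) → Φ.excDivAt R c k j = Ideal.span {deltaVar R r}) ∧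
    (∀ j : Fin Φ.N, Φ.labAt c k j = none → Φ.excDivAt R c k j = ⊤)

/-! ### Prop. 5.12 — the torus action (PARTIAL reading; OPT-adjacent) -/

/-- The weights of the chart variables after the ϑ-steps of the word, from weights `wt` on `Var_{𝔙_[0]}` (a ϖ-step at `u_k` makes
`x_{𝔙,(m,u_k)} = ξ_1 = x_{𝔙',(m,u_k)}/x_{𝔙',u_k}` of weight `wt (m,u_k) − wt u_k`; a ϱ-step makes `x_{𝔙,u_k} = ξ_0` of weight
`wt u_k − wt (m,u_k)`; exceptional variables keep their weight; C37L141–L150, C38L11–L20, cf. Prop. 5.10 proof C36L159–L174).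
OURS bookkeeping for `Prop5_12_weak`.
[claim: Hu2025, status: under-review]
STATUS: candidate statement under adjudication (D-0012/D-0089); not asserted — OURS bookkeeping. -/
def wtAt {M : Type*} [AddCommGroup M] (wt : P ⊕ Rs → M) (c : Φ.Chart) (k : ℕ) : P ⊕ Rs → M :=
  ((List.finRange Φ.N).filter fun j : Fin Φ.N => decide (j.val < k)).foldl
    (fun w j =>
      (Φ.lead j).elim w fun r => (c j).by
        (Function.update w (Sum.inr r) (w (Sum.inr r) - w (Sum.inl (Φ.ult j))))
        (Function.update w (Sum.inl (Φ.ult j)) (w (Sum.inl (Φ.ult j)) - w (Sum.inr r))))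
    wt

/-- **Proposition 5.12 (C38L56–L62; p.88) — WEAK READING, NAMED AS SUCH (`_weak`): «quasi-free» is NOT encoded; OPT-adjacent
(PARTITION-HU §2: torus actions are index-only in M-Hu-min; row 106 lists `Prop5_12`; lane-A pre-read res-ref-a10 2026-08-27T05:35:49Z:
«suggest SKIP or a _weak name» — the owner/res-lit-6 may still SKIP it).** «The quasi-free 𝕋-action on Ṽ_{ϑ[k]} [sic: ϑ[k−1]]
lifts to a quasi-free 𝕋-action on Ṽ_{ϑ[k]}.» Printed proof: «This follows from Lemma (Taction-vt)» (= Prop. 5.10). Chart-level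
reading typed: for a weight function `wt` on `Var_{𝔙_[0]}` with values in an abelian group (the character lattice of
`𝕋 = 𝔾_m^n/𝔾_m`; the weights of `x_u`, `x_{(u,v)}` are rows 101/103's data, here a parameter) such that the starting relations
`eqns0` are weighted-homogeneous, the ideal of `Ṽ_{ϑ[k]} ∩ 𝔙` is generated by elements weighted-homogeneous for the lifted
weights `wtAt` — i.e. `Ṽ_{ϑ[k]} ∩ 𝔙` is 𝕋-stable. NOT ENCODED: «quasi-free» (C34L51–L56: every isotropy subgroup connected).
[claim: Hu2025, status: under-review]
STATUS: candidate statement under adjudication (D-0012/D-0089); not asserted — WEAK reading (quasi-freeness omitted). -/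
def _root_.Literature.AlgebraicGeometry.Hu2025.Statements.S05ThetaBlowups.Prop5_12_weak
    (Φ : ThetaFrame P Rs) (R : Type u) [CommRing R] {M : Type*} [AddCommGroup M] (wt : P ⊕ Rs → M) : Prop :=
  (∀ f ∈ Φ.eqns0 R, ∃ d : M, MvPolynomial.IsWeightedHomogeneous wt f d) →
    ∀ (c : Φ.Chart) (k : ℕ), k ≤ Φ.N →
      ∃ S : Set (MvPolynomial (P ⊕ Rs) R), Ideal.span S = Φ.idealVTilde R c k ∧
        ∀ f ∈ S, ∃ d : M, MvPolynomial.IsWeightedHomogeneous (Φ.wtAt wt c k) f d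


end WithRing

end ThetaFrame

end Literature.AlgebraicGeometry.Hu2025.Statements.S05ThetaBlowups

end
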